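/-
Copyright: the b2b-balaban cell (near-miss cell 7), T⁴-continuum fan-out; row NE7b ROUND-2 swarm, seat
t4-ne7b-formalise-leaf-03 (gen 2) (row S12 «ASSEMBLY», sub-row S12e «THE MULTIPLICITY SOCKET END» of
`t4/b2b-balaban-t4-ne7b-p1/LEAVES-NE7b.md`, rulings R-OWNER-22-24 (2) ∕ R-OWNER-22-25 (3), finding F-leaf10g5-1; node A12-I.M
of the typer's `t4/formal/NE7b/DAG.md`).  Released under the licence of the surrounding project.
-/
import Summits.QuantumFields.BalabanUV.T4Continuum.Support.HistoryAssemblyMultKey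
import Summits.QuantumFields.BalabanUV.T4Continuum.Support.HistoryAssemblyRealisePrice

/-!
# History assembly: the ENDs with the SLOT MULTIPLICITY as a named binder (the S6g′-instance socket)

Summits-side support file of the T⁴-continuum cell (rung (B)+1 on a FINITE torus only; NOT infinite volume, NOT the
mass gap, NOT the Clay statement; NOT a proof of the spine estimate NE7b).  Sub-row S12e «THE MULTIPLICITY SOCKET END»
(R-OWNER-22-24 (2)) of row S12, node A12-I.M of the typer's `t4/formal/NE7b/DAG.md`: the KERNEL-side consumer of row
S6g′'s INSTANCE (ruling R-OWNER-22-23 (1)–(2): target `#{histories read into (x, G)} ≤ exp((θ_S+θ_a)·F + Ξ)·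
Λm^{partnerAges}`, the class-linear part consumed by the birth-credit slack `e^{θ·birthLinT}`, the `Ξ`-part paid on H3's
side of the price sentence).  [folklore] composition of landed lemmas by name; no new definition, no `[cite:]` tag,
nothing printed asserted.

WHAT.  §1 **`hybridNE7_of_termReadingLE_mult`** = `HistoryAssemblyTermsLE.hybridNE7_of_termReadingLE_canon` (generic
term layer, LE currency) with H3's numerator and price readings RE-KEYED BY FINE MEMBER FAMILIES over an abstract key
`ω` (`gmem : ℕ → ι → Finset ω`, `gslot : ω → BSlot γ PEv`, the two compatibilities «slot family of `gmem K τ` =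
`bstrOf sh mem K τ`» and «`gslot` injective on `gmem K τ`» displayed): `upM` ∕ `deadM_nonneg` ∕ `resumM` ∕ `FM_nonneg`
(+ primed run) over `k ∈ HistoryAssemblyMult.badGMems mem jhalf T gmem K`, `τ ∈ fibre gmem T K k`, the per-family
price reading `FcM K (gmem K τ)·RfM K (gmem K τ) ≤ ∏_{w ∈ gmem K τ} p K w` for an abstract nonnegative price `p`, and
the PER-OCCUPANT binder `hocc : #gocc s · p K w ≤ bslotPrice (yT …) s`; the placement sum is done in the kernel
(`HistoryAssemblyMult.hF_of_multReading`: `Fc := 1`, `dead := deadC`, `Rf := RfC`, labelled price `yT`) over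
`HistoryAssemblyTreesLE.hybridNE7_of_treeBinders_canonLE`; conclusion string-identical (coarse classes).
§2 **`hybridNE7_of_realisedReading_printedMult`** = `HistoryAssemblyRealisePrice.hybridNE7_of_realisedReading_printedSlack`
with that re-keying for the member-KEY families `HistoryAssemblyMultKey.kmemOf ped liveC cellOf phys K τ` (root cell +
flat genealogy + an ABSTRACT physical reading `phys : ℕ → ι → α → δ`, the consumer's datum — leaf-10 g5's F-leaf10g5-1:
an ORDERED carrier would count sibling-order orbit elements; both compatibilities PROVED, `injOn` from `cell_inj`), H3's
per-term price sentence over its named members in PRINT's currency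
`pshapeTH Prod.fst O C 1 Λr (R K) g_K 0 (κ K q) q.2 · e^{−Ξ K q}` (NO slack factor; residual partner letter `Λr`; the
renewal-entropy allowance `Ξ` DISCOUNTED, i.e. paid on H3's side — the kernel takes per key the maximum
`supPriceK` over its realisers), and ONE new named binder — THE SLOT MULTIPLICITY OF THE KEYS
**`hmult : #koccOf … K (kslot (keyOf … K τ c)) ≤ exp(θ·birthLinT Prod.fst ((ped K τ).genT c) + Ξ K (cellOf K τ c,
(ped K τ).genT c))·Λm^{partnerAges (PEv.step ∘ Prod.fst) ((ped K τ).genT c)}`** for every live component `c` of every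
bad term `τ` (`koccOf` = the distinct (root cell, flat genealogy, physical datum) keys of bad terms' live components at
that tree slot), under `0 ≤ θ`, `C.a + θ ≤ ½·O.γ₀·O.A₁²`, `0 ≤ Λm`, `0 ≤ Λr`, `Λm·Λr ≤ L^d`; the per-occupant bound follows by
`HistoryAssemblyMult.card_mul_pshapeTH_le_priceT` + `HistoryAssemblyMultKey.hocc_of_boundK` (profile floor from
`1 ≤ C.A₀`, the flow's `1 ≤ log g_{K,s}⁻²` and `ConsistentTLE.step_le` of the realised members, as in the slack END).
`hmult` is row S6g′'s INSTANCE target in this END's letters: when proved for the realised reading, the placement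
entropy is ABSORBED in the kernel with no `BirthShapeNodup` ∕ `hent` ∕ rank-fibre display (`ACCEPT-A12I.md` v1.6
zone-form wording; typer T-NE7b-10 «multiplicity form»).

CENSUS vs `hybridNE7_of_realisedReading_printedSlack` (p216884): only-in-Mult = {`phys`, `Λm Λr` + `hΛm hΛr hΛmr`, `Ξ`,
`hmult`, `FcM RfM FcM′ RfM′`-keyed `hPM hPM′ upM deadM_nonneg resumM FM_nonneg` + primed}; only-in-Slack = {`Fc Rf Fc′
Rf′`-keyed `hP hP′ up dead_nonneg resum F_nonneg` + primed}; everything else VERBATIM; conclusion IDENTICAL.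

HONEST DEPENDENCY (cell): continuum YM on T⁴ ⇐ BetaPertH ∧ nine spine estimates (0/9 proved); BetaPertH ⇐ (D1) ∧ (D4)
∧ CAP+tail.  Nothing of H3 ∕ (B) ∕ BetaPertH is discharged here; `hmult` is DISPLAYED, not proved; NE7b is NOT proved;
no date.
-/

open Finset MeasureTheory
open Literature.MathematicalPhysics.QuantumFieldTheory.Balaban1983to89
open T4PersistenceDictionary T4PersistentHistoryCount T4BankedInduction T4PrintedShapeBanking
open T4WeightBudget T4GlobalDenominator T4LiveClassFibration T4LiveStructureGas T4LiveGasToTerms T4RecordPriceSeam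
open T4PartnerMultiplicity T4IndicatorShell T4MatchingAssembly T4MatchingClosure T4MatchingClosureSocket T4Continuum
open T4StabilitySocket T4BranchingRecordsGas T4TaggedShapeBanking T4CanonicalMenus T4RenewalChains
open Summit.QuantumFields.BalabanUV.T4Continuum.PlacementBatch
open Summit.QuantumFields.BalabanUV.T4Continuum.PlacementSkeleton
open Summit.QuantumFields.BalabanUV.T4Continuum.CountThresholdUniform
open Summit.QuantumFields.BalabanUV.T4Continuum.CountThresholdExit
open Summit.QuantumFields.BalabanUV.T4Continuum.CountSeamJunction
open Summit.QuantumFields.BalabanUV.T4Continuum.LateMergers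
open Summit.QuantumFields.BalabanUV.T4Continuum.HistoryFlow
open Summit.QuantumFields.BalabanUV.T4Continuum.HistoryRegeneration
open Summit.QuantumFields.BalabanUV.T4Continuum.HistoryTables
open Summit.QuantumFields.BalabanUV.T4Continuum.HistoryAssemblyTrees
open Summit.QuantumFields.BalabanUV.T4Continuum.HistoryAssemblyTerms
open Summit.QuantumFields.BalabanUV.T4Continuum.HistoryAssemblyPedigree
open Summit.QuantumFields.BalabanUV.T4Continuum.HistoryConstants
open Summit.QuantumFields.BalabanUV.T4Continuum.HistoryGen
open Literature.MathematicalPhysics.QuantumFieldTheory.Balaban1983to89.B13ScaleTransfer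
open Summit.QuantumFields.BalabanUV.T4Continuum.ZoneSkeleton
open Summit.QuantumFields.BalabanUV.T4Continuum.HistorySocketTH
open Summit.QuantumFields.BalabanUV.T4Continuum.HistoryCaps
open Summit.QuantumFields.BalabanUV.T4Continuum.HistoryAssemblyPrice
open Summit.QuantumFields.BalabanUV.T4Continuum.HistoryBankingLE
open Summit.QuantumFields.BalabanUV.T4Continuum.HistoryExitLE
open Summit.QuantumFields.BalabanUV.T4Continuum.HistoryAssemblyTreesLE
open Summit.QuantumFields.BalabanUV.T4Continuum.HistoryAssemblyTermsLE
open Summit.QuantumFields.BalabanUV.T4Continuum.HistoryRealise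
open Summit.QuantumFields.BalabanUV.T4Continuum.HistoryAssemblyRealiseLE
open Summit.QuantumFields.BalabanUV.T4Continuum.HistoryAssemblyMult
open Summit.QuantumFields.BalabanUV.T4Continuum.HistoryAssemblyMultKey

namespace Summit.QuantumFields.BalabanUV.T4Continuum.HistoryAssemblyRealiseMult

noncomputable section

/-! ## §1 The generic term-level END with the fine families and the per-occupant multiplicity binder -/

section Terms

variable {F : T4Family} {G : Type*} [GaugeGroup G] [MeasurableSpace G] [HaarData G] [RegularGaugeGroup G]
variable {ε : Type*} [DecidableEq ε] {ω : Type*} [DecidableEq ω]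
variable {ι : Type*} [DecidableEq ι] {l₀ vol : ℝ} {K₀ : ℕ} {T : ℕ → Finset ι} {A A' shA shB : ℕ → ℝ → ι → ℝ}
  {dead dead' : ℕ → ℝ → ι → ℝ} {nup mup : ℕ → ℝ → ℝ} {Nup : ℝ}
  {Cc Rr CcRec RrRec : ℕ → ℝ → ι → ℝ} {ν u s₂ q₀ r s Wsh : ℕ → ℝ}

/-- **NE7b's COUNT EXIT WITH THE LIVE STRUCTURES READ PER TERM (LE) AND THE NUMERATOR READ OVER FINE MEMBER
FAMILIES.**  `HistoryAssemblyTermsLE.hybridNE7_of_termReadingLE_canon` with: a fine member map `gmem` into an abstract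
key type with slots `gslot` (displayed: the slot family of `gmem K τ` is the term's live class, `gslot` is injective
on `gmem K τ`); H3's `Regeneration` numerator readings over the FINE classes (`k ∈ badGMems mem jhalf T gmem K`,
fibres `fibre gmem T K k`); the per-family price reading against an abstract nonnegative per-member price `p` (run 1) ∕
`p′` (run 2); and the PER-OCCUPANT multiplicity binder `hocc : #gocc s · p K w ≤ bslotPrice (yT …) s`.  The sum over
the placements of a slot family is taken in the kernel (`HistoryAssemblyMult.hF_of_multReading`).  Displayed otherwise
as there; conclusion identical. [folklore] -/
theorem hybridNE7_of_termReadingLE_mult (D : FiniteEpsData F G) (sh : ε → PEv) {C : T4PrintedShapeBanking.Consts}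
    {rr : ℕ} {β₀ : ℝ} (h : ThresholdOK C F.L rr β₀) (hμ : 0 < C.μ) (d n : ℕ) (Dcap Ncap : ℕ → ℕ)
    (hκ₁ : (d : ℝ) * Real.log F.L + 2 * Real.log 2 ≤ C.κ₁) (hE₀ : Real.log (2 + birthMass C) ≤ C.E₀)
    -- the flow side (⇐ BetaPertH, displayed) and tuning
    {γ₀ γb b β' : ℝ} {pe : ℕ} (hb : 0 ≤ b) (hlo : FlowStep.BetaLowerH b γ₀ D.βfun)
    (hhi : FlowStep.BetaUpperH β' γ₀ D.βfun) (hγ : γb ≤ γ₀) (hγβ : γb ^ 2 * β' < 1)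
    (S : B14FlowStep.SmallnessFor γb β' β₀ F.L pe) (hp₀ : C.p₀ ≤ pe) (hrr : rr ≤ pe)
    {g : ℝ} {g₀ : ℕ → ℝ} (ht : D.Tuned γb g g₀)
    (hir : irThresholdTLE C F.L rr β₀ ≤ Real.log (g ^ 2)⁻¹)
    -- the (B) side
    (hsign : B16.SignConventions D.C) {γB : ℝ} {em ep : ℝ → ℝ} (hcor : B16.Cor3With D.C γB em ep) (hγB : γb ≤ γB)
    {obs : (K : ℕ) → GaugeField (F.P K) 0 G → ℝ} {B : ℝ}
    (hobs : ∀ K, Measurable (obs K)) (hbd : ∀ K U, |obs K U| ≤ B)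
    (hα : ∀ K t, |t| ≤ l₀ → K₀ ≤ K →
      ∫ U, Real.exp (t * obs K U) * D.dens K (g₀ K) 0 U ∂fieldMeasure (F.P K) 0 G ≤ ∑ τ ∈ T K, A K t τ)
    (hα' : ∀ K t, |t| ≤ l₀ → K₀ ≤ K →
      ∫ U, Real.exp (t * obs (K + 1) U) * D.dens (K + 1) (g₀ (K + 1)) 0 U ∂fieldMeasure (F.P (K + 1)) 0 G ≤
        ∑ τ ∈ T K, A' K t τ)
    {c₀ n₁ : ℝ} (hc₀ : 0 < c₀) (hfloor : ∀ K, K₀ ≤ K → c₀ ≤ smallFieldMass D K (g₀ K))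
    (hfloor' : ∀ K, K₀ ≤ K → c₀ ≤ smallFieldMass D (K + 1) (g₀ (K + 1)))
    (hsites : ∀ K, K₀ ≤ K → ((D.C ⟨K, F.m, g₀ K⟩).numSites K : ℝ) ≤ n₁)
    (hsites' : ∀ K, K₀ ≤ K → ((D.C ⟨K + 1, F.m, g₀ (K + 1)⟩).numSites (K + 1) : ℝ) ≤ n₁)
    (hNup : 0 ≤ Nup) (hnup : ∀ K t, |t| ≤ l₀ → K₀ ≤ K → 0 ≤ nup K t ∧ nup K t ≤ Nup)
    (hmup : ∀ K t, |t| ≤ l₀ → K₀ ≤ K → 0 ≤ mup K t ∧ mup K t ≤ Nup)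
    -- the (2.5) side condition on the size function
    (R : ℕ → ℕ → ℕ) (hR : ∀ K s, s ≤ K → B14.IsRj F.L rr ((D.C ⟨K, F.m, g₀ K⟩).flow.g s) (R K s))
    -- H3, PER TERM: the live members of the terms and their reading
    (mem : ℕ → ι → Finset ((Fin d → ℕ) × Gen ε))
    (H : TermReadingLE sh C (cellN d n F.L) Dcap Ncap jhalf K₀ R T mem)
    -- the FINE member families and their slots (displayed compatibilities with the live classes)
    (gmem : ℕ → ι → Finset ω) (gslot : ω → BSlot (Fin d → ℕ) PEv)
    (hslots : ∀ K, K₀ ≤ K → ∀ τ ∈ T K, (gmem K τ).image gslot = bstrOf sh mem K τ)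
    (hginj : ∀ K, K₀ ≤ K → ∀ τ ∈ badTerms mem jhalf T K, Set.InjOn gslot (gmem K τ : Set ω))
    -- a nonnegative per-member price for each run, and THE PER-OCCUPANT MULTIPLICITY BOUND at every tree slot
    (p p' : ℕ → ω → ℝ) (hp : ∀ K w, 0 ≤ p K w) (hp' : ∀ K w, 0 ≤ p' K w)
    (hocc : ∀ K, K₀ ≤ K → ∀ s, ∀ w ∈ gocc mem jhalf T gmem gslot K s,
      ((gocc mem jhalf T gmem gslot K s).card : ℝ) * p K w ≤
        bslotPrice (yT sh C ((F.L : ℝ) ^ d) R (fun K => (D.C ⟨K, F.m, g₀ K⟩).flow.g) mem jhalf T K) s)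
    (hocc' : ∀ K, K₀ ≤ K → ∀ s, ∀ w ∈ gocc mem jhalf T gmem gslot K s,
      ((gocc mem jhalf T gmem gslot K s).card : ℝ) * p' K w ≤
        bslotPrice (yT sh C ((F.L : ℝ) ^ d) R (fun K => (D.C ⟨K, F.m, g₀ K⟩).flow.g) mem jhalf T K) s)
    -- H3, PER FINE MEMBER FAMILY: the live price of the family of every bad term, both runs
    {FcM RfM FcM' RfM' : ℕ → Finset ω → ℝ}
    (hPM : ∀ K t, |t| ≤ l₀ → K₀ ≤ K → ∀ τ ∈ badTerms mem jhalf T K,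
      FcM K (gmem K τ) * RfM K (gmem K τ) ≤ ∏ w ∈ gmem K τ, p K w)
    (hPM' : ∀ K t, |t| ≤ l₀ → K₀ ≤ K → ∀ τ ∈ badTerms mem jhalf T K,
      FcM' K (gmem K τ) * RfM' K (gmem K τ) ≤ ∏ w ∈ gmem K τ, p' K w)
    -- H3: the remaining `Regeneration` numerator readings, over the FINE families of the bad terms (the dead parts of
    -- the histories with the same fine family resummed; no placement sum inside)
    (upM : ∀ K t, |t| ≤ l₀ → K₀ ≤ K → ∀ k ∈ badGMems mem jhalf T gmem K, ∀ τ ∈ fibre gmem T K k,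
      A K t τ ≤ dead K t τ * FcM K k * nup K t)
    (deadM_nonneg : ∀ K t, |t| ≤ l₀ → K₀ ≤ K → ∀ k ∈ badGMems mem jhalf T gmem K, ∀ τ ∈ fibre gmem T K k,
      0 ≤ dead K t τ)
    (resumM : ∀ K t, |t| ≤ l₀ → K₀ ≤ K → ∀ k ∈ badGMems mem jhalf T gmem K,
      ∑ τ ∈ fibre gmem T K k, dead K t τ ≤ RfM K k)
    (FM_nonneg : ∀ K t, |t| ≤ l₀ → K₀ ≤ K → ∀ k ∈ badGMems mem jhalf T gmem K, 0 ≤ FcM K k)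
    (upM' : ∀ K t, |t| ≤ l₀ → K₀ ≤ K → ∀ k ∈ badGMems mem jhalf T gmem K, ∀ τ ∈ fibre gmem T K k,
      A' K t τ ≤ dead' K t τ * FcM' K k * mup K t)
    (deadM'_nonneg : ∀ K t, |t| ≤ l₀ → K₀ ≤ K → ∀ k ∈ badGMems mem jhalf T gmem K, ∀ τ ∈ fibre gmem T K k,
      0 ≤ dead' K t τ)
    (resumM' : ∀ K t, |t| ≤ l₀ → K₀ ≤ K → ∀ k ∈ badGMems mem jhalf T gmem K,
      ∑ τ ∈ fibre gmem T K k, dead' K t τ ≤ RfM' K k)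
    (FM'_nonneg : ∀ K t, |t| ≤ l₀ → K₀ ≤ K → ∀ k ∈ badGMems mem jhalf T gmem K, 0 ≤ FcM' K k)
    -- the seam's other inputs
    (hSh : ShellWeightBound l₀ T A A' shA shB Wsh)
    (hTB : ReindexedBudget l₀ vol T (fun K t τ => A K t τ - shA K t τ) (fun K t τ => A' K t τ - shB K t τ)
      (badOfClass (bstrOf sh mem) T (fun K _ => badClasses sh mem jhalf T K)) Cc Rr CcRec RrRec ν u s₂ q₀ r s)
    (hr : Summable r) (hu : Summable u) (hs : Summable s) (hs₂ : Summable s₂) :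
    ∃ K₁ K₂, K₀ ≤ K₁ ∧ HybridNE7 l₀ vol (fun K => T (K₁ + (K₂ + K))) (fun K => A (K₁ + (K₂ + K)))
      (fun K => A' (K₁ + (K₂ + K)))
      (fun K => badOfClass (bstrOf sh mem) T (fun K _ => badClasses sh mem jhalf T K) (K₁ + (K₂ + K)))
      (fun K => constOf l₀ B (max (em g) 0) n₁ c₀ Nup *
        recordsBudget (birthMass C) C.κ₁ ((n : ℝ) ^ d) ((F.L : ℝ) ^ d) (Real.log 2) jhalf (K₁ + (K₂ + K)))
      (fun K => shA (K₁ + (K₂ + K))) (fun K => shB (K₁ + (K₂ + K))) (fun K => Wsh (K₁ + (K₂ + K)))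
      (fun K => (r (K₁ + (K₂ + K)) + u (K₁ + (K₂ + K))) + (s (K₁ + (K₂ + K)) + s₂ (K₁ + (K₂ + K)))) := by
  have hLpos : (0 : ℝ) < F.L := by exact_mod_cast (lt_of_lt_of_le (by norm_num) (two_le_L F))
  have hΛ : (0 : ℝ) ≤ (F.L : ℝ) ^ d := pow_nonneg hLpos.le d
  exact hybridNE7_of_treeBinders_canonLE D sh h hμ d n Dcap Ncap hκ₁ hE₀ hb hlo hhi hγ hγβ S hp₀ hrr ht hir hsign hcor
    hγB hobs hbd hα hα' hc₀ hfloor hfloor' hsites hsites' hNup hnup hmup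
    (π := bstrOf sh mem) (Bad' := fun K _ => badClasses sh mem jhalf T K)
    (Fc := fun _ _ => (1 : ℝ)) (Rf := RfC mem jhalf T gmem gslot FcM RfM) (Fc' := fun _ _ => (1 : ℝ))
    (Rf' := RfC mem jhalf T gmem gslot FcM' RfM') (dead := deadC gmem FcM dead) (dead' := deadC gmem FcM' dead')
    (fun K _ _ _ => badClasses_subset_classIndex sh mem jhalf T K)
    (up_coarse upM) (deadC_nonneg deadM_nonneg FM_nonneg) (resum_coarse hslots resumM FM_nonneg)
    (fun _ _ _ _ _ _ => zero_le_one)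
    (up_coarse upM') (deadC_nonneg deadM'_nonneg FM'_nonneg) (resum_coarse hslots resumM' FM'_nonneg)
    (fun _ _ _ _ _ _ => zero_le_one) R hR
    (yT sh C ((F.L : ℝ) ^ d) R (fun K => (D.C ⟨K, F.m, g₀ K⟩).flow.g) mem jhalf T)
    (fun K j _ z _ Gs _ => yT_nonneg hΛ K j z Gs)
    (fun K hK j hj z hz Gs hGs => hlabTLE_of_termReadingLE H (canonFam Dcap Ncap) K hK j hj z hz Gs hGs)
    (fun _ c => c) (fun K t _ _ => Set.injOn_id _)
    (fun K t _ hK c hc => hstr_of_termReadingLE H K hK hc)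
    (hF_of_multReading hΛ hginj hp hocc hPM) (hF_of_multReading hΛ hginj hp' hocc' hPM') hSh hTB hr hu hs hs₂

end Terms

/-! ## §2 The END with realised pending pedigrees, printed prices, and the slot multiplicity displayed -/

section End

variable {F : T4Family} {G : Type*} [GaugeGroup G] [MeasurableSpace G] [HaarData G] [RegularGaugeGroup G]
variable {α π δ : Type*} [DecidableEq α] [DecidableEq π] [DecidableEq δ] {dP : ℕ} {sP : ℕ → ℕ}
variable {ι : Type*} [DecidableEq ι] {l₀ vol : ℝ} {K₀ : ℕ} {T : ℕ → Finset ι} {A A' shA shB : ℕ → ℝ → ι → ℝ}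
  {dead dead' : ℕ → ℝ → ι → ℝ} {nup mup : ℕ → ℝ → ℝ} {Nup : ℝ}
  {Cc Rr CcRec RrRec : ℕ → ℝ → ι → ℝ} {ν u s₂ q₀ r s Wsh : ℕ → ℝ}

/-- **NE7b's COUNT EXIT WITH THE LIVE STRUCTURES READ AS REALISED PENDING PEDIGREES, THE PRICES READ IN PRINT'S
CURRENCY, AND THE SLOT MULTIPLICITY OF THE MEMBER KEYS DISPLAYED** (the S6g′-instance socket).
`HistoryAssemblyRealisePrice.hybridNE7_of_realisedReading_printedSlack` with H3's numerator readings RE-KEYED by the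
member-KEY families `kmemOf ped liveC cellOf phys K τ` — root cell, flat genealogy and an ABSTRACT physical reading
`phys : ℕ → ι → α → δ` chosen by the consumer (`upM`∕`deadM_nonneg`∕`resumM`∕`FM_nonneg`: print's resummation over the
histories with the SAME physical live data — dead parts only), H3's per-term price sentence
over its named members in PRINT's currency `pshapeTH Prod.fst O C 1 Λr (R K) g_K 0 (κ K q) q.2 · e^{−Ξ K q}` (no slack
factor; the renewal allowance `Ξ` discounted, i.e. paid on H3's side), and the ONE new binder **`hmult`**: for every
live component `c` of every bad term `τ`, the number of distinct (root cell, flat genealogy, physical datum) keys of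
bad terms' live components at `c`'s tree slot is `≤ exp(θ·birthLinT Prod.fst ((ped K τ).genT c) + Ξ K (cellOf K τ c,
(ped K τ).genT c))·Λm^{partnerAges (PEv.step ∘ Prod.fst) ((ped K τ).genT c)}` — row S6g′'s INSTANCE target; `0 ≤ θ`,
`C.a + θ ≤ ½·O.γ₀·O.A₁²`, `0 ≤ Λm`, `0 ≤ Λr`, `Λm·Λr ≤ L^d`.  Everything else VERBATIM as the slack END; conclusion
identical. [folklore] -/
theorem hybridNE7_of_realisedReading_printedMult (D : FiniteEpsData F G) {C : T4PrintedShapeBanking.Consts}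
    {O : PrintedO1s}
    {rr : ℕ} {β₀ : ℝ} (h : ThresholdOK C F.L rr β₀) (hμ : 0 < C.μ) (d n : ℕ)
    (hκ₁ : (d : ℝ) * Real.log F.L + 2 * Real.log 2 ≤ C.κ₁) (hE₀ : Real.log (2 + birthMass C) ≤ C.E₀)
    -- the profile floor `p₀(g) ≥ 1` along the runs comes from `1 ≤ A₀` and the flow's `log g⁻² ≥ 1`
    (hA₀ : 1 ≤ C.A₀)
    -- the flow side (⇐ BetaPertH, displayed) and tuning
    {γ₀ γb b β' : ℝ} {pe : ℕ} (hb : 0 ≤ b) (hlo : FlowStep.BetaLowerH b γ₀ D.βfun)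
    (hhi : FlowStep.BetaUpperH β' γ₀ D.βfun) (hγ : γb ≤ γ₀) (hγβ : γb ^ 2 * β' < 1)
    (S : B14FlowStep.SmallnessFor γb β' β₀ F.L pe) (hp₀ : C.p₀ ≤ pe) (hrr : rr ≤ pe)
    {g : ℝ} {g₀ : ℕ → ℝ} (ht : D.Tuned γb g g₀)
    (hir : irThresholdTLE C F.L rr β₀ ≤ Real.log (g ^ 2)⁻¹)
    -- the (B) side
    (hsign : B16.SignConventions D.C) {γB : ℝ} {em ep : ℝ → ℝ} (hcor : B16.Cor3With D.C γB em ep) (hγB : γb ≤ γB)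
    {obs : (K : ℕ) → GaugeField (F.P K) 0 G → ℝ} {B : ℝ}
    (hobs : ∀ K, Measurable (obs K)) (hbd : ∀ K U, |obs K U| ≤ B)
    (hα : ∀ K t, |t| ≤ l₀ → K₀ ≤ K →
      ∫ U, Real.exp (t * obs K U) * D.dens K (g₀ K) 0 U ∂fieldMeasure (F.P K) 0 G ≤ ∑ τ ∈ T K, A K t τ)
    (hα' : ∀ K t, |t| ≤ l₀ → K₀ ≤ K →
      ∫ U, Real.exp (t * obs (K + 1) U) * D.dens (K + 1) (g₀ (K + 1)) 0 U ∂fieldMeasure (F.P (K + 1)) 0 G ≤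
        ∑ τ ∈ T K, A' K t τ)
    {c₀ n₁ : ℝ} (hc₀ : 0 < c₀) (hfloor : ∀ K, K₀ ≤ K → c₀ ≤ smallFieldMass D K (g₀ K))
    (hfloor' : ∀ K, K₀ ≤ K → c₀ ≤ smallFieldMass D (K + 1) (g₀ (K + 1)))
    (hsites : ∀ K, K₀ ≤ K → ((D.C ⟨K, F.m, g₀ K⟩).numSites K : ℝ) ≤ n₁)
    (hsites' : ∀ K, K₀ ≤ K → ((D.C ⟨K + 1, F.m, g₀ (K + 1)⟩).numSites (K + 1) : ℝ) ≤ n₁)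
    (hNup : 0 ≤ Nup) (hnup : ∀ K t, |t| ≤ l₀ → K₀ ≤ K → 0 ≤ nup K t ∧ nup K t ≤ Nup)
    (hmup : ∀ K t, |t| ≤ l₀ → K₀ ≤ K → 0 ≤ mup K t ∧ mup K t ≤ Nup)
    -- the (2.5) side condition on the size function
    (R : ℕ → ℕ → ℕ) (hR : ∀ K s, s ≤ K → B14.IsRj F.L rr ((D.C ⟨K, F.m, g₀ K⟩).flow.g s) (R K s))
    -- H3: the terms read as PEDIGREES of live components with root cells, and their reading
    -- the side conditions of the geometric lemmas (row S1b): torus side, drop control, window constant, size function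
    (hL4 : 4 ≤ F.L) (hdrop : ∀ m, B16SProfile.DropCtl sP m) (hn₁ : 13 ≤ C.n₁) (hR1 : ∀ K, K₀ ≤ K → ∀ t, 1 ≤ R K t)
    (ped : ℕ → ι → Pedigree α π) (cellP : ℕ → ι → π → Pt dP × Finset (Pt dP)) (liveC : ℕ → ι → Finset α)
    (cellOf : ℕ → ι → α → (Fin d → ℕ))
    (H : RealisedReading F.L sP (cellN d n F.L) K₀ R T ped cellP liveC cellOf)
    -- the PHYSICAL READING of the live components (the consumer's datum: which components of different terms are the same)
    (phys : ℕ → ι → α → δ)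
    -- the class-linear slack: `C.a + θ ≤ ½γ₀A₁²` pays the factor `e^{θ·birthLinT}` of the slot multiplicity
    {θ : ℝ} (hθ : 0 ≤ θ) (hslack : C.a + θ ≤ O.γ₀ * O.A₁ ^ 2 / 2)
    -- the partner letters: `Λm` for the slot multiplicity, `Λr` left in H3's printed price, `Λm·Λr ≤ L^d`
    {Λm Λr : ℝ} (hΛm : 0 ≤ Λm) (hΛr : 0 ≤ Λr) (hΛmr : Λm * Λr ≤ (F.L : ℝ) ^ d)
    -- H3: realised per-step costs of the live members, read below the model's booked cost (reading (ID-a))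
    (κ κ' : ℕ → (Fin d → ℕ) × Gen (Lab α π) → Gen (Lab α π) → ℕ → ℝ)
    (hκ : ∀ K, K₀ ≤ K → ∀ τ ∈ badTerms (memOf ped liveC cellOf) jhalf T K, ∀ q ∈ memOf ped liveC cellOf K τ,
      ∀ m ∈ life (padW (dictWT Prod.fst (R K) C.n₁) 0) q.2,
        κ K q q.2 m ≤ costT Prod.fst C K (R K) q.2 m)
    (hκ' : ∀ K, K₀ ≤ K → ∀ τ ∈ badTerms (memOf ped liveC cellOf) jhalf T K, ∀ q ∈ memOf ped liveC cellOf K τ,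
      ∀ m ∈ life (padW (dictWT Prod.fst (R K) C.n₁) 0) q.2,
        κ' K q q.2 m ≤ costT Prod.fst C K (R K) q.2 m)
    -- row S6g′'s INSTANCE: the renewal-entropy allowance `Ξ` and THE SLOT MULTIPLICITY OF THE KEYS
    (Ξ : ℕ → (Fin d → ℕ) × Gen (Lab α π) → ℝ)
    (hmult : ∀ K, K₀ ≤ K → ∀ τ ∈ badTerms (memOf ped liveC cellOf) jhalf T K, ∀ c ∈ liveC K τ,
      ((koccOf ped liveC cellOf phys jhalf T K (kslot (keyOf ped cellOf phys K τ c))).card : ℝ) ≤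
        Real.exp (θ * birthLinT Prod.fst ((ped K τ).genT c) + Ξ K (cellOf K τ c, (ped K τ).genT c)) *
          Λm ^ partnerAges (PEv.step ∘ Prod.fst) ((ped K τ).genT c))
    -- H3: the per-term price sentence over the named members in PRINT's currency, discounted by the allowance; the
    -- live price of the member-KEY family; both runs
    {FcM RfM FcM' RfM' : ℕ → Finset ((Fin d → ℕ) × Gen PEv × δ) → ℝ}
    (hPM : ∀ K t, |t| ≤ l₀ → K₀ ≤ K → ∀ τ ∈ badTerms (memOf ped liveC cellOf) jhalf T K,
      FcM K (kmemOf ped liveC cellOf phys K τ) * RfM K (kmemOf ped liveC cellOf phys K τ) ≤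
        ∏ q ∈ memOf ped liveC cellOf K τ,
          pshapeTH Prod.fst O C 1 Λr (R K) (D.C ⟨K, F.m, g₀ K⟩).flow.g 0 (κ K q) q.2 * Real.exp (-Ξ K q))
    (hPM' : ∀ K t, |t| ≤ l₀ → K₀ ≤ K → ∀ τ ∈ badTerms (memOf ped liveC cellOf) jhalf T K,
      FcM' K (kmemOf ped liveC cellOf phys K τ) * RfM' K (kmemOf ped liveC cellOf phys K τ) ≤
        ∏ q ∈ memOf ped liveC cellOf K τ,
          pshapeTH Prod.fst O C 1 Λr (R K) (D.C ⟨K, F.m, g₀ K⟩).flow.g 0 (κ' K q) q.2 * Real.exp (-Ξ K q))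
    -- H3: the remaining `Regeneration` numerator readings, over the member-KEY families of the bad terms
    (upM : ∀ K t, |t| ≤ l₀ → K₀ ≤ K →
      ∀ k ∈ badGMems (memOf ped liveC cellOf) jhalf T (kmemOf ped liveC cellOf phys) K,
        ∀ τ ∈ fibre (kmemOf ped liveC cellOf phys) T K k, A K t τ ≤ dead K t τ * FcM K k * nup K t)
    (deadM_nonneg : ∀ K t, |t| ≤ l₀ → K₀ ≤ K →
      ∀ k ∈ badGMems (memOf ped liveC cellOf) jhalf T (kmemOf ped liveC cellOf phys) K,
        ∀ τ ∈ fibre (kmemOf ped liveC cellOf phys) T K k, 0 ≤ dead K t τ)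
    (resumM : ∀ K t, |t| ≤ l₀ → K₀ ≤ K →
      ∀ k ∈ badGMems (memOf ped liveC cellOf) jhalf T (kmemOf ped liveC cellOf phys) K,
        ∑ τ ∈ fibre (kmemOf ped liveC cellOf phys) T K k, dead K t τ ≤ RfM K k)
    (FM_nonneg : ∀ K t, |t| ≤ l₀ → K₀ ≤ K →
      ∀ k ∈ badGMems (memOf ped liveC cellOf) jhalf T (kmemOf ped liveC cellOf phys) K, 0 ≤ FcM K k)
    (upM' : ∀ K t, |t| ≤ l₀ → K₀ ≤ K →
      ∀ k ∈ badGMems (memOf ped liveC cellOf) jhalf T (kmemOf ped liveC cellOf phys) K,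
        ∀ τ ∈ fibre (kmemOf ped liveC cellOf phys) T K k, A' K t τ ≤ dead' K t τ * FcM' K k * mup K t)
    (deadM'_nonneg : ∀ K t, |t| ≤ l₀ → K₀ ≤ K →
      ∀ k ∈ badGMems (memOf ped liveC cellOf) jhalf T (kmemOf ped liveC cellOf phys) K,
        ∀ τ ∈ fibre (kmemOf ped liveC cellOf phys) T K k, 0 ≤ dead' K t τ)
    (resumM' : ∀ K t, |t| ≤ l₀ → K₀ ≤ K →
      ∀ k ∈ badGMems (memOf ped liveC cellOf) jhalf T (kmemOf ped liveC cellOf phys) K,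
        ∑ τ ∈ fibre (kmemOf ped liveC cellOf phys) T K k, dead' K t τ ≤ RfM' K k)
    (FM'_nonneg : ∀ K t, |t| ≤ l₀ → K₀ ≤ K →
      ∀ k ∈ badGMems (memOf ped liveC cellOf) jhalf T (kmemOf ped liveC cellOf phys) K, 0 ≤ FcM' K k)
    -- the seam's other inputs
    (hSh : ShellWeightBound l₀ T A A' shA shB Wsh)
    (hTB : ReindexedBudget l₀ vol T (fun K t τ => A K t τ - shA K t τ) (fun K t τ => A' K t τ - shB K t τ)
      (badOfClass (HistorySocketTH.bstrOf Prod.fst (memOf ped liveC cellOf)) T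
        (fun K _ => badClasses Prod.fst (memOf ped liveC cellOf) jhalf T K)) Cc Rr CcRec RrRec ν u s₂ q₀ r s)
    (hr : Summable r) (hu : Summable u) (hs : Summable s) (hs₂ : Summable s₂) :
    ∃ K₁ K₂, K₀ ≤ K₁ ∧ HybridNE7 l₀ vol (fun K => T (K₁ + (K₂ + K))) (fun K => A (K₁ + (K₂ + K)))
      (fun K => A' (K₁ + (K₂ + K)))
      (fun K => badOfClass (HistorySocketTH.bstrOf Prod.fst (memOf ped liveC cellOf)) T
        (fun K _ => badClasses Prod.fst (memOf ped liveC cellOf) jhalf T K) (K₁ + (K₂ + K)))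
      (fun K => constOf l₀ B (max (em g) 0) n₁ c₀ Nup *
        recordsBudget (birthMass C) C.κ₁ ((n : ℝ) ^ d) ((F.L : ℝ) ^ d) (Real.log 2) jhalf (K₁ + (K₂ + K)))
      (fun K => shA (K₁ + (K₂ + K))) (fun K => shB (K₁ + (K₂ + K))) (fun K => Wsh (K₁ + (K₂ + K)))
      (fun K => (r (K₁ + (K₂ + K)) + u (K₁ + (K₂ + K))) + (s (K₁ + (K₂ + K)) + s₂ (K₁ + (K₂ + K)))) := by
  -- the profile floor at the members' birth steps: `ConsistentTLE.step_le` + the flow's `log g⁻² ≥ 1` + `1 ≤ A₀`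
  obtain ⟨-, -, hx1, -⟩ := flowBinders_of_tuned D hb hlo hhi hγ hγβ S hp₀ hrr ht R hR
  have HT := termReadingLE_of_realised (C := C) hL4 hdrop hn₁ hR1 H jhalf
  have hP1 : ∀ K, K₀ ≤ K → ∀ τ ∈ badTerms (memOf ped liveC cellOf) jhalf T K, ∀ q ∈ memOf ped liveC cellOf K τ,
      ∀ e ∈ q.2.events, (Prod.fst e).kind = 0 →
        1 ≤ p0Profile C.A₀ C.p₀ ((D.C ⟨K, F.m, g₀ K⟩).flow.g (Prod.fst e).step) :=
    fun K hK τ hτ q hq e he _ =>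
      PartnerMultiplicityF.one_le_p0Profile hA₀ C.p₀ (hx1 K _ ((HT.consistent K hK τ hτ q hq).step_le e he))
  -- the per-occupant bound from the slot multiplicity, for a cost reading `κ₀`
  have hoccOf : ∀ κ₀ : ℕ → (Fin d → ℕ) × Gen (Lab α π) → Gen (Lab α π) → ℕ → ℝ,
      (∀ K, K₀ ≤ K → ∀ τ ∈ badTerms (memOf ped liveC cellOf) jhalf T K, ∀ q ∈ memOf ped liveC cellOf K τ,
        ∀ m ∈ life (padW (dictWT Prod.fst (R K) C.n₁) 0) q.2, κ₀ K q q.2 m ≤ costT Prod.fst C K (R K) q.2 m) →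
      ∀ K, K₀ ≤ K → ∀ s, ∀ w ∈ koccOf ped liveC cellOf phys jhalf T K s,
        ((koccOf ped liveC cellOf phys jhalf T K s).card : ℝ) *
            supPriceK ped liveC cellOf phys jhalf T
              (fun K q => pshapeTH Prod.fst O C 1 Λr (R K) (D.C ⟨K, F.m, g₀ K⟩).flow.g 0 (κ₀ K q) q.2 *
                Real.exp (-Ξ K q)) K w ≤
          bslotPrice (yT Prod.fst C ((F.L : ℝ) ^ d) R (fun K => (D.C ⟨K, F.m, g₀ K⟩).flow.g)
            (memOf ped liveC cellOf) jhalf T K) s := by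
    intro κ₀ hκ₀ K hK
    refine hocc_of_boundK fun τ hτ c hc => ?_
    have hq : (cellOf K τ c, (ped K τ).genT c) ∈ memOf ped liveC cellOf K τ := mem_memOf.2 ⟨c, hc, rfl⟩
    exact card_mul_pshapeTH_le_priceT Prod.fst hθ hslack hΛm hΛr hΛmr R (fun K => (D.C ⟨K, F.m, g₀ K⟩).flow.g) K
      (hP1 K hK τ hτ _ hq) (hκ₀ K hK τ hτ _ hq) (hmult K hK τ hτ c hc)
  have hpr : ∀ (κ₀ : ℕ → (Fin d → ℕ) × Gen (Lab α π) → Gen (Lab α π) → ℕ → ℝ) (K : ℕ)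
      (q : (Fin d → ℕ) × Gen (Lab α π)),
      0 ≤ pshapeTH Prod.fst O C 1 Λr (R K) (D.C ⟨K, F.m, g₀ K⟩).flow.g 0 (κ₀ K q) q.2 * Real.exp (-Ξ K q) :=
    fun κ₀ K q => mul_nonneg (pshapeTH_nonneg Prod.fst zero_le_one hΛr _ _ _ _ _) (Real.exp_pos _).le
  exact hybridNE7_of_termReadingLE_mult D Prod.fst h hμ d n (dcapOf Prod.fst T (memOf ped liveC cellOf))
    (ncapOf T (memOf ped liveC cellOf)) hκ₁ hE₀ hb hlo hhi hγ hγβ S hp₀ hrr ht hir hsign hcor hγB hobs hbd hα hα' hc₀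
    hfloor hfloor' hsites hsites' hNup hnup hmup R hR (memOf ped liveC cellOf) HT
    (kmemOf ped liveC cellOf phys) kslot
    (fun K hK τ hτ => image_kslot_kmemOf)
    (fun K hK τ hτ => injOn_kslot_kmemOf (H.cell_inj K hK τ (mem_badTerms.1 hτ).1))
    (supPriceK ped liveC cellOf phys jhalf T fun K q =>
      pshapeTH Prod.fst O C 1 Λr (R K) (D.C ⟨K, F.m, g₀ K⟩).flow.g 0 (κ K q) q.2 * Real.exp (-Ξ K q))
    (supPriceK ped liveC cellOf phys jhalf T fun K q =>
      pshapeTH Prod.fst O C 1 Λr (R K) (D.C ⟨K, F.m, g₀ K⟩).flow.g 0 (κ' K q) q.2 * Real.exp (-Ξ K q))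
    (fun K w => supPriceK_nonneg (hpr κ K) w) (fun K w => supPriceK_nonneg (hpr κ' K) w)
    (hoccOf κ hκ) (hoccOf κ' hκ')
    (fun K t ht hK τ hτ => (hPM K t ht hK τ hτ).trans
      (prod_memOf_le_prod_supPriceK (phys := phys)
        (pr := fun K q => pshapeTH Prod.fst O C 1 Λr (R K) (D.C ⟨K, F.m, g₀ K⟩).flow.g 0 (κ K q) q.2 *
          Real.exp (-Ξ K q)) (hpr κ K) hτ (H.cell_inj K hK τ (mem_badTerms.1 hτ).1)))
    (fun K t ht hK τ hτ => (hPM' K t ht hK τ hτ).trans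
      (prod_memOf_le_prod_supPriceK (phys := phys)
        (pr := fun K q => pshapeTH Prod.fst O C 1 Λr (R K) (D.C ⟨K, F.m, g₀ K⟩).flow.g 0 (κ' K q) q.2 *
          Real.exp (-Ξ K q)) (hpr κ' K) hτ (H.cell_inj K hK τ (mem_badTerms.1 hτ).1)))
    upM deadM_nonneg resumM FM_nonneg upM' deadM'_nonneg resumM' FM'_nonneg hSh hTB hr hu hs hs₂

end End

end

end Summit.QuantumFields.BalabanUV.T4Continuum.HistoryAssemblyRealiseMult
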